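import Literature.NumberTheory.Automorphic.HaarIntegralClosedCompact
import Literature.MeasureTheory.Group.NonRegularHaar
import Mathlib.MeasureTheory.Integral.Bochner.Set
import Mathlib.MeasureTheory.Integral.Bochner.ContinuousLinearMap
import Mathlib.Topology.UrysohnsLemma
import HarnessLib

/-!
# `DeitmarEchterhoff2014_prop156` is false as stated (non-Radon Haar measures)

Topic `NumberTheory/Automorphic`; namespace `Literature.NumberTheory.Automorphic`. A formal refutation
of the named fact `DeitmarEchterhoff2014_prop156` of `HaarIntegralClosedCompact.lean` in universe
`0`: that `def` quantifies over *all* Haar measures in Mathlib's sense (`IsHaarMeasure`: left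
invariant, finite on compacts, positive on opens), whereas Deitmar–Echterhoff's Prop. 1.5.6 is
about Haar measures in the book's sense (outer **Radon**, Thm. 1.3.5), and on a non-σ-compact group
two Mathlib Haar measures need not be proportional.

The counterexample (`Literature.MeasureTheory.Group.NonRegularHaar`): `G = ℝ × ℝ_discrete`
(multiplicatively: `Multiplicative LinePlane`), `H = ⊤`, `K = ⊥`, `μ_G = lineSum` (sum over `y` of
Lebesgue measure on the line `ℝ × {y}`), `μ_H = lineSumTop` (equal to `lineSum` on sets inside
countably many lines, `∞` otherwise) transported to `↥⊤`, `μ_K = δ_1`. For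
`f = g₀ + 1_A`, `A = {0} × ℝ_d` the vertical line (`lineSum A = 0`, `lineSumTop A = ∞`) and `g₀` a
nonnegative bump supported on the line `y = 0` with `g₀(0, 0) > 0`: `f ∈ L¹(μ_G)` with
`∫ f dμ_G = ∫ g₀ dμ_G > 0`, while `h ↦ ∫_K f(hk) dμ_K = f(h)` is not `μ_H`-integrable (its
indicator part has infinite mass), so the asserted identity would give `∫ f dμ_G = c · 0 = 0`.

The corrected (Radon) statement `DeitmarEchterhoff2014_prop156_radon` is stated and proved in
`HaarIntegralClosedCompact.lean` / `HaarIntegralClosedCompactRadon.lean` (once those land).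

## References

* A. Deitmar, S. Echterhoff, *Principles of Harmonic Analysis* (2014), Prop. 1.5.6, Thm. 1.3.5.
  [DeitmarEchterhoff2014]
* Mathlib, `Mathlib/MeasureTheory/Measure/Haar/Unique.lean`, module docstring. [folklore]
-/

noncomputable section

open MeasureTheory Measure Set Topology Filter Literature.MeasureTheory.Group
open scoped ENNReal

namespace Literature.NumberTheory.Automorphic

/-- **`DeitmarEchterhoff2014_prop156` (as vendored, quantifying over all Mathlib Haar measures) is
false.** See the module docstring for the counterexample. [folklore] -/
theorem not_DeitmarEchterhoff2014_prop156 : ¬ DeitmarEchterhoff2014_prop156.{0} := by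
  classical
  intro hDE
  -- the group `G = ℝ × ℝ_d`, written multiplicatively, with its Borel (= product) σ-algebra
  letI : MeasurableSpace (Multiplicative LinePlane) := (inferInstance : MeasurableSpace LinePlane)
  haveI : BorelSpace (Multiplicative LinePlane) := ⟨BorelSpace.measurable_eq (α := LinePlane)⟩
  haveI : T2Space (Multiplicative LinePlane) := inferInstanceAs (T2Space LinePlane)
  -- the two Haar measures, viewed on the multiplicative copy
  let μ : Measure (Multiplicative LinePlane) := (lineSum : Measure LinePlane)
  let μ' : Measure (Multiplicative LinePlane) := (lineSumTop : Measure LinePlane)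
  haveI : IsFiniteMeasureOnCompacts μ :=
    ⟨fun C hC => IsFiniteMeasureOnCompacts.lt_top_of_isCompact (μ := lineSum) hC⟩
  haveI : IsOpenPosMeasure μ := ⟨fun U hU hne => IsOpenPosMeasure.open_pos (μ := lineSum) U hU hne⟩
  haveI : μ.IsMulLeftInvariant :=
    ⟨fun g => map_add_left_eq_self (μ := lineSum) (Multiplicative.toAdd g)⟩
  haveI : IsHaarMeasure μ := ⟨⟩
  haveI : IsFiniteMeasureOnCompacts μ' :=
    ⟨fun C hC => IsFiniteMeasureOnCompacts.lt_top_of_isCompact (μ := lineSumTop) hC⟩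
  haveI : IsOpenPosMeasure μ' :=
    ⟨fun U hU hne => IsOpenPosMeasure.open_pos (μ := lineSumTop) U hU hne⟩
  haveI : μ'.IsMulLeftInvariant :=
    ⟨fun g => map_add_left_eq_self (μ := lineSumTop) (Multiplicative.toAdd g)⟩
  haveI : IsHaarMeasure μ' := ⟨⟩
  -- `μ_H`: transport of `μ'` to the subgroup `⊤`
  let e : Multiplicative LinePlane ≃* (⊤ : Subgroup (Multiplicative LinePlane)) :=
    Subgroup.topEquiv.symm
  have he : Continuous e := continuous_id.subtype_mk _
  have hesymm : Continuous e.symm := continuous_subtype_val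
  let μH : Measure (⊤ : Subgroup (Multiplicative LinePlane)) := Measure.map e μ'
  haveI : IsHaarMeasure μH := MulEquiv.isHaarMeasure_map (μ := μ') e he hesymm
  -- `μ_K = δ_1` on the trivial subgroup
  let μK : Measure (⊥ : Subgroup (Multiplicative LinePlane)) := Measure.dirac 1
  haveI : IsOpenPosMeasure μK := ⟨fun U _ ⟨x, hx⟩ => by
    have h1 : (1 : (⊥ : Subgroup (Multiplicative LinePlane))) ∈ U := by
      rwa [Subsingleton.elim (1 : (⊥ : Subgroup (Multiplicative LinePlane))) x]
    simp [μK, Measure.dirac_apply_of_mem h1]⟩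
  haveI : μK.IsMulLeftInvariant := ⟨fun g => by
    rw [Subsingleton.elim g 1]
    simp [μK]⟩
  haveI : IsHaarMeasure μK := ⟨⟩
  -- apply the fact
  have hH : IsClosed ((⊤ : Subgroup (Multiplicative LinePlane)) : Set (Multiplicative LinePlane)) := by
    rw [Subgroup.coe_top]; exact isClosed_univ
  have hK : IsCompact ((⊥ : Subgroup (Multiplicative LinePlane)) : Set (Multiplicative LinePlane)) := by
    rw [Subgroup.coe_bot]; exact isCompact_singleton
  have hHK : ∀ g : Multiplicative LinePlane, ∃ h ∈ (⊤ : Subgroup (Multiplicative LinePlane)),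
      ∃ k ∈ (⊥ : Subgroup (Multiplicative LinePlane)), g = h * k :=
    fun g => ⟨g, Subgroup.mem_top g, 1, Subgroup.one_mem _, (mul_one g).symm⟩
  obtain ⟨c, -, hall⟩ := hDE (Multiplicative LinePlane) ⊤ ⊥ hH hK hHK μ μH μK
  -- the test function: a bump on the line `y = 0` plus the indicator of the vertical line
  obtain ⟨⟨φ, hφc⟩, hφs, hφ0, hφ00⟩ := exists_continuous_nonneg_pos (0 : ℝ)
  let χ : DiscreteReal → ℝ := fun y => if y = 0 then 1 else 0
  have hχ : Continuous χ := continuous_of_discreteTopology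
  let g₀ : Multiplicative LinePlane → ℝ := fun p => φ (Multiplicative.toAdd p).1 * χ (Multiplicative.toAdd p).2
  have hg₀c : Continuous g₀ :=
    (hφc.comp (continuous_fst.comp continuous_toAdd)).mul
      (hχ.comp (continuous_snd.comp continuous_toAdd))
  have hg₀s : HasCompactSupport g₀ := by
    refine HasCompactSupport.intro'
      (K := (Multiplicative.toAdd) ⁻¹' (tsupport φ ×ˢ ({0} : Set DiscreteReal)))
      (hφs.isCompact.prod isCompact_singleton) ?_ (fun p hp => ?_)
    · exact ((isClosed_tsupport φ).prod (isClosed_discrete _)).preimage continuous_toAdd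
    · simp only [mem_preimage, mem_prod, mem_singleton_iff, not_and_or] at hp
      rcases hp with hp | hp
      · simp [g₀, image_eq_zero_of_notMem_tsupport hp]
      · have : χ (Multiplicative.toAdd p).2 = 0 := if_neg hp
        simp [g₀, this]
  have hχnn : ∀ y, 0 ≤ χ y := fun y => by
    by_cases hy : y = 0
    · simp [χ, hy]
    · simp [χ, hy]
  have hg₀nn : 0 ≤ g₀ := fun p => mul_nonneg (hφ0 _) (hχnn _)
  have hg₀one : g₀ (Multiplicative.ofAdd ((0 : ℝ), (0 : DiscreteReal))) ≠ 0 := by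
    have hχ0 : χ 0 = 1 := if_pos rfl
    have : g₀ (Multiplicative.ofAdd ((0 : ℝ), (0 : DiscreteReal))) = φ 0 * χ 0 := rfl
    rw [this, hχ0, mul_one]
    exact hφ00
  let A : Set (Multiplicative LinePlane) := (vertical : Set LinePlane)
  have hAm : MeasurableSet A := isClosed_vertical.measurableSet
  have hμA : μ A = 0 := lineSum_vertical
  have hμ'A : μ' A = ∞ := lineSumTop_vertical
  let f : Multiplicative LinePlane → ℂ := fun p => (g₀ p : ℂ) + A.indicator (fun _ => (1 : ℂ)) p
  -- `f ∈ L¹(μ)` with `∫ f dμ = ∫ g₀ dμ ≠ 0`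
  have hg₀i : Integrable (fun p => (g₀ p : ℂ)) μ :=
    (Complex.continuous_ofReal.comp hg₀c).integrable_of_hasCompactSupport
      (hg₀s.comp_left Complex.ofReal_zero)
  have hAi : Integrable (A.indicator fun _ => (1 : ℂ)) μ :=
    (integrable_indicator_iff hAm).2 (integrableOn_const (by simp [hμA]))
  have hfi : Integrable f μ := hg₀i.add hAi
  have hint : ∫ p, f p ∂μ = ((∫ p, g₀ p ∂μ : ℝ) : ℂ) := by
    simp only [f]
    rw [integral_add hg₀i hAi, integral_complex_ofReal, integral_indicator_const _ hAm,
      measureReal_def, hμA, ENNReal.toReal_zero, zero_smul, add_zero]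
  have hpos : 0 < ∫ p, g₀ p ∂μ :=
    hg₀c.integral_pos_of_hasCompactSupport_nonneg_nonzero hg₀s hg₀nn hg₀one
  -- `f` is not `μ'`-integrable (its indicator part has infinite mass)
  have hnot : ¬ Integrable f μ' := by
    intro hf'
    have hg₀i' : Integrable (fun p => (g₀ p : ℂ)) μ' :=
      (Complex.continuous_ofReal.comp hg₀c).integrable_of_hasCompactSupport
        (hg₀s.comp_left Complex.ofReal_zero)
    have hind : Integrable (A.indicator fun _ => (1 : ℂ)) μ' := by
      have := hf'.sub hg₀i'
      refine this.congr (Eventually.of_forall fun p => ?_)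
      simp [f]
    rw [integrable_indicator_iff hAm, integrableOn_const_iff] at hind
    rcases hind with h0 | hlt
    · simp at h0
    · exact absurd hμ'A hlt.ne
  -- evaluate the right-hand side of the asserted identity: it is `c * 0`
  have hinner : ∀ h : (⊤ : Subgroup (Multiplicative LinePlane)),
      ∫ k, f ((h : Multiplicative LinePlane) * (k : Multiplicative LinePlane)) ∂μK =
        f (h : Multiplicative LinePlane) := by
    intro h
    have : (fun k : (⊥ : Subgroup (Multiplicative LinePlane)) =>
        f ((h : Multiplicative LinePlane) * (k : Multiplicative LinePlane))) =
        fun _ => f (h : Multiplicative LinePlane) := by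
      funext k
      rw [Subgroup.mem_bot.mp k.2, mul_one]
    rw [this, integral_const]
    simp [μK]
  have houter : ∫ h, f (h : Multiplicative LinePlane) ∂μH = 0 := by
    have hfm : AEStronglyMeasurable
        (fun h : (⊤ : Subgroup (Multiplicative LinePlane)) => f (h : Multiplicative LinePlane))
        (Measure.map e μ') := by
      refine (Measurable.aestronglyMeasurable ?_)
      refine ((Complex.measurable_ofReal.comp hg₀c.measurable).add
        (measurable_const.indicator hAm)).comp measurable_subtype_coe
    rw [show μH = Measure.map e μ' from rfl,
      integral_map he.measurable.aemeasurable hfm]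
    exact integral_undef hnot
  have key := hall f hfi
  simp_rw [hinner] at key
  rw [houter, mul_zero, hint] at key
  exact hpos.ne' (by exact_mod_cast key)

end Literature.NumberTheory.Automorphic
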